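import Mathlib
import HarnessLib
import Literature.NumberTheory.LFunctions.ZetaScrew
import Literature.NumberTheory.LFunctions.ZetaScrewLogTwoPos
import Literature.Analysis.SpecialFunctions.EulerMascheroniBounds
import Summits.RiemannHypothesis.RiemannHypothesis.Theorems.IntegerScrewDefs
import Summits.RiemannHypothesis.RiemannHypothesis.Theorems.IntegerScrewNestedSylvester
import Summits.RiemannHypothesis.RiemannHypothesis.Theorems.IntegerScrewPivotCriterion
import Summits.RiemannHypothesis.RiemannHypothesis.Theorems.IntegerScrewRungThree

/-!
# Route `IntegerScrew` — the THIRD RUNG, unconditionally: `det S_4 > 0`, `d_4 > 0`, `S_4 ≻ 0`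

Continuation of `IntegerScrewRungThree`: the `3 × 3` screw Gram matrix on `log 2, log 3, log 4` is
positive definite RH-free, so `d_4 = det S_4/det S_3 > 0` (numerically `0.06287`; `det S_4 = 5.66e−4`,
certified `> 2e−4`). New inputs: `Ψ(log 4)` (`P(log 4) = (log 2)²/√2 + (log 3)(log 4 − log 3)/√3`,
`√4 = 2`, Lerch ratio `1/16`) and `Ψ(log(4/3))` (wall, ratio `9/16`, 26 terms), each to `±4e−4`
after subtracting `C/4`; entries `K(log 2, log 4) = Ψ(log 4)`, `K(log 3, log 4) = Ψ(log 3) + Ψ(log 4)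
− Ψ(log(4/3))`. Rank-one trick at size 3: with `C ≥ 17.1721` (forty terms) the matrix is
`S₀ + δ(I + J)/4`, `δ ≥ 0`, and `det = det S₀ + c₁δ + c₂δ² + δ³/16` with `c₁, c₂ ≥ 0` certified from
the entry boxes (`det_three_proxy_pos`, pure algebra), so `det S_4 ≥ det S₀ > 0`; then Sylvester for
the nested family. Main: **`screwDet_three_pos`**, **`screwPivot_four_pos`**, **`screwMatrix_three_posDef`**.
Nothing here bears on the truth of RH. `Ψ`: Suzuki, J. Lond. Math. Soc. 108 (2023), (1.1) [Suzuki2023].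
-/

noncomputable section

-- D-0017: `Summit.<S>.<S>.…` is the designed namespace of a single-problem summit.
set_option linter.dupNamespace false

namespace Summit.RiemannHypothesis.RiemannHypothesis.Theorems.IntegerScrew

open Literature.NumberTheory.LFunctions Finset
open scoped BigOperators

/-- Product of two interval-bounded non-negative quantities. [folklore] -/
private theorem mul_bounds₄ {x y a b c d : ℝ} (ha : a ≤ x) (hb : x ≤ b) (hc : c ≤ y) (hd : y ≤ d)
    (ha0 : 0 ≤ a) (hc0 : 0 ≤ c) : a * c ≤ x * y ∧ x * y ≤ b * d :=
  ⟨mul_le_mul ha hc hc0 (le_trans ha0 ha),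
    mul_le_mul hb hd (le_trans hc0 hc) (le_trans ha0 (le_trans ha hb))⟩

/-- `5.3714 < A < 5.3723`, `A = γ₀ + π/2 + 3 log 2 + log π` (as in `IntegerScrewRungThree`). [folklore] -/
private theorem slope_bounds₄ :
    (5.3714 : ℝ) < Real.eulerMascheroniConstant + Real.pi / 2 + 3 * Real.log 2 + Real.log Real.pi ∧
    Real.eulerMascheroniConstant + Real.pi / 2 + 3 * Real.log 2 + Real.log Real.pi < 5.3723 := by
  have h1 := Literature.Analysis.SpecialFunctions.Real.eulerMascheroniConstant_gt_d8
  have h2 := Literature.Analysis.SpecialFunctions.Real.eulerMascheroniConstant_lt_d8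
  have h7 : (1.144 : ℝ) < Real.log Real.pi := by
    rw [Real.lt_log_iff_exp_lt Real.pi_pos]
    have e1 : Real.exp (0.144 : ℝ) ≤ 1.15504 := by
      have := Real.exp_bound' (show (0 : ℝ) ≤ 0.144 by norm_num) (show (0.144 : ℝ) ≤ 1 by norm_num)
        (n := 3) (by norm_num)
      norm_num [Finset.sum_range_succ, Nat.factorial] at this ⊢; linarith
    have e2 : Real.exp (1.144 : ℝ) = Real.exp 1 * Real.exp 0.144 := by rw [← Real.exp_add]; norm_num
    calc Real.exp (1.144 : ℝ) = Real.exp 1 * Real.exp 0.144 := e2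
      _ ≤ 2.7182818286 * 1.15504 := mul_le_mul Real.exp_one_lt_d9.le e1 (Real.exp_pos _).le (by norm_num)
      _ < 3.141592 := by norm_num
      _ < Real.pi := Real.pi_gt_d6
  have h8 : Real.log Real.pi < 1.1448 := by
    rw [Real.log_lt_iff_lt_exp Real.pi_pos]
    have e1 : (1.15578 : ℝ) ≤ Real.exp 0.1448 := by
      have := Real.sum_le_exp_of_nonneg (show (0 : ℝ) ≤ 0.1448 by norm_num) 4
      norm_num [Finset.sum_range_succ, Nat.factorial] at this ⊢; linarith
    have e2 : Real.exp (1.1448 : ℝ) = Real.exp 1 * Real.exp 0.1448 := by rw [← Real.exp_add]; norm_num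
    calc Real.pi < 3.141593 := Real.pi_lt_d6
      _ < 2.7182818283 * 1.15578 := by norm_num
      _ ≤ Real.exp 1 * Real.exp 0.1448 := mul_le_mul Real.exp_one_gt_d9.le e1 (by norm_num) (Real.exp_pos 1).le
      _ = Real.exp 1.1448 := e2.symm
  constructor <;> linarith [Real.pi_gt_d6, Real.pi_lt_d6, Real.log_two_gt_d9, Real.log_two_lt_d9]

/-- `1.0986 < log 3 < 1.0987` (as in `IntegerScrewRungThree`). [folklore] -/
private theorem log_three_bounds₄ : (1.0986 : ℝ) < Real.log 3 ∧ Real.log 3 < 1.0987 := by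
  constructor
  · rw [Real.lt_log_iff_exp_lt (by norm_num)]
    have h1 : Real.exp (0.0986 : ℝ) ≤ 1.103626 := by
      have := Real.exp_bound' (show (0 : ℝ) ≤ 0.0986 by norm_num) (show (0.0986 : ℝ) ≤ 1 by norm_num)
        (n := 4) (by norm_num)
      norm_num [Finset.sum_range_succ, Nat.factorial] at this ⊢; linarith
    have h2 : Real.exp (1.0986 : ℝ) = Real.exp 1 * Real.exp 0.0986 := by rw [← Real.exp_add]; norm_num
    calc Real.exp (1.0986 : ℝ) = Real.exp 1 * Real.exp 0.0986 := h2
      _ ≤ 2.7182818286 * 1.103626 := mul_le_mul Real.exp_one_lt_d9.le h1 (Real.exp_pos _).le (by norm_num)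
      _ < 3 := by norm_num
  · rw [Real.log_lt_iff_lt_exp (by norm_num)]
    have h1 : (1.103734 : ℝ) ≤ Real.exp 0.0987 := by
      have := Real.sum_le_exp_of_nonneg (show (0 : ℝ) ≤ 0.0987 by norm_num) 5
      norm_num [Finset.sum_range_succ, Nat.factorial] at this ⊢; linarith
    have h2 : Real.exp (1.0987 : ℝ) = Real.exp 1 * Real.exp 0.0987 := by rw [← Real.exp_add]; norm_num
    calc (3 : ℝ) < 2.7182818283 * 1.103734 := by norm_num
      _ ≤ Real.exp 1 * Real.exp 0.0987 := mul_le_mul Real.exp_one_gt_d9.le h1 (by norm_num) (Real.exp_pos 1).le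
      _ = Real.exp 1.0987 := h2.symm

/-- Summability of `r^k/(k+¼)²`, `0 ≤ r ≤ 1`. [folklore] -/
private theorem summable_geom_lerch₄ {r : ℝ} (hr0 : 0 ≤ r) (hr1 : r ≤ 1) :
    Summable fun k : ℕ => r ^ k / ((k : ℝ) + 1 / 4) ^ 2 := by
  refine summable_one_div_nat_add_quarter_sq.of_nonneg_of_le (fun k => by positivity) fun k => ?_
  exact div_le_div_of_nonneg_right (pow_le_one₀ hr0 hr1) (by positivity)

/-- Two-sided bounds for `Σ r^k/(k+¼)²`: partial sum below, partial sum + geometric tail above. [folklore] -/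
private theorem geom_lerch_bounds₄ {r : ℝ} (hr0 : 0 ≤ r) (hr1 : r < 1) (K : ℕ) :
    ∑ k ∈ Finset.range K, r ^ k / ((k : ℝ) + 1 / 4) ^ 2 ≤ ∑' k : ℕ, r ^ k / ((k : ℝ) + 1 / 4) ^ 2 ∧
    ∑' k : ℕ, r ^ k / ((k : ℝ) + 1 / 4) ^ 2 ≤
      ∑ k ∈ Finset.range K, r ^ k / ((k : ℝ) + 1 / 4) ^ 2 + r ^ K / (((K : ℝ) + 1 / 4) ^ 2 * (1 - r)) := by
  have hs := summable_geom_lerch₄ hr0 hr1.le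
  refine ⟨hs.sum_le_tsum _ fun k _ => by positivity, ?_⟩
  rw [← hs.sum_add_tsum_nat_add K]
  refine add_le_add le_rfl ?_
  have hgeom : Summable fun i : ℕ => r ^ K / ((K : ℝ) + 1 / 4) ^ 2 * r ^ i :=
    (summable_geometric_of_lt_one hr0 hr1).mul_left _
  have hterm : ∀ i : ℕ, r ^ (i + K) / (((i + K : ℕ) : ℝ) + 1 / 4) ^ 2
      ≤ r ^ K / ((K : ℝ) + 1 / 4) ^ 2 * r ^ i := by
    intro i
    have hi : (0 : ℝ) ≤ i := Nat.cast_nonneg i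
    have hDK : (0 : ℝ) < ((K : ℝ) + 1 / 4) ^ 2 := by positivity
    have hinv : (((i : ℝ) + K + 1 / 4) ^ 2)⁻¹ ≤ (((K : ℝ) + 1 / 4) ^ 2)⁻¹ :=
      inv_anti₀ hDK (pow_le_pow_left₀ (by positivity) (by linarith) 2)
    calc r ^ (i + K) / (((i + K : ℕ) : ℝ) + 1 / 4) ^ 2
        = r ^ K * r ^ i * (((i : ℝ) + K + 1 / 4) ^ 2)⁻¹ := by
          push_cast; rw [pow_add, div_eq_mul_inv]; ring
      _ ≤ r ^ K * r ^ i * (((K : ℝ) + 1 / 4) ^ 2)⁻¹ :=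
          mul_le_mul_of_nonneg_left hinv (by positivity)
      _ = r ^ K / ((K : ℝ) + 1 / 4) ^ 2 * r ^ i := by rw [div_eq_mul_inv]; ring
  calc ∑' i : ℕ, r ^ (i + K) / (((i + K : ℕ) : ℝ) + 1 / 4) ^ 2
      ≤ ∑' i : ℕ, r ^ K / ((K : ℝ) + 1 / 4) ^ 2 * r ^ i :=
        Summable.tsum_le_tsum hterm ((summable_nat_add_iff K).mpr hs) hgeom
    _ = r ^ K / ((K : ℝ) + 1 / 4) ^ 2 * ∑' i : ℕ, r ^ i := tsum_mul_left
    _ = r ^ K / (((K : ℝ) + 1 / 4) ^ 2 * (1 - r)) := by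
        rw [tsum_geometric_of_lt_one hr0 hr1]; field_simp

/-- `Φ(log 4) = Σ 16^{−k}(k+¼)^{−2} ∈ [16.0407955, 16.0407956]`. [folklore] -/
private theorem lerch_four_bounds :
    (16.0407955 : ℝ) ≤ ∑' k : ℕ, (((4:ℝ) ^ 2)⁻¹) ^ k / ((k : ℝ) + 1 / 4) ^ 2 ∧
    ∑' k : ℕ, (((4:ℝ) ^ 2)⁻¹) ^ k / ((k : ℝ) + 1 / 4) ^ 2 ≤ 16.0407956 := by
  have h := geom_lerch_bounds₄ (r := ((4:ℝ) ^ 2)⁻¹) (by norm_num) (by norm_num) 6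
  norm_num [Finset.sum_range_succ] at h ⊢
  constructor <;> linarith [h.1, h.2]

/-- `Φ(log(4/3)) = Σ (9/16)^k (k+¼)^{−2} ∈ [16.448356, 16.4483561]`. [folklore] -/
private theorem lerch_four_thirds_bounds :
    (16.448356 : ℝ) ≤ ∑' k : ℕ, (((4/3:ℝ) ^ 2)⁻¹) ^ k / ((k : ℝ) + 1 / 4) ^ 2 ∧
    ∑' k : ℕ, (((4/3:ℝ) ^ 2)⁻¹) ^ k / ((k : ℝ) + 1 / 4) ^ 2 ≤ 16.4483561 := by
  have h := geom_lerch_bounds₄ (r := ((4/3:ℝ) ^ 2)⁻¹) (by norm_num) (by norm_num) 26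
  norm_num [Finset.sum_range_succ] at h ⊢
  constructor <;> linarith [h.1, h.2]

/-- `C = Σ (k+¼)^{−2} ≥ 17.1721` (forty terms). [folklore] -/
private theorem lerch_const_ge₄ : (17.1721 : ℝ) ≤ ∑' k : ℕ, 1 / ((k : ℝ) + 1 / 4) ^ 2 := by
  refine le_trans ?_ (summable_one_div_nat_add_quarter_sq.sum_le_tsum (Finset.range 40)
    fun k _ => by positivity)
  norm_num [Finset.sum_range_succ]

/-- `P(log 4) = (log 2/√2)(log 4 − log 2) + (log 3/√3)(log 4 − log 3)` (prime powers `2, 3` below `4`;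
the term `n = 4` carries the factor `log 4 − log 4 = 0`). [folklore] -/
theorem zetaScrewPrimeSum_log_four :
    zetaScrewPrimeSum (Real.log 4) = Real.log 2 / Real.sqrt 2 * (Real.log 4 - Real.log 2)
      + Real.log 3 / Real.sqrt 3 * (Real.log 4 - Real.log 3) := by
  have hl4 : 0 < Real.log 4 := Real.log_pos (by norm_num)
  unfold zetaScrewPrimeSum
  rw [abs_of_pos hl4, Real.exp_log (by norm_num : (0:ℝ) < 4)]
  have hfl : ⌊(4 : ℝ)⌋₊ = 4 := by norm_num
  rw [hfl, show Finset.Icc (1 : ℕ) 4 = {1, 2, 3, 4} from by decide]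
  rw [Finset.sum_insert (by decide), Finset.sum_insert (by decide), Finset.sum_pair (by norm_num)]
  have h1 : ArithmeticFunction.vonMangoldt 1 = 0 := ArithmeticFunction.vonMangoldt_apply_one
  have h2 : ArithmeticFunction.vonMangoldt 2 = Real.log 2 := by
    rw [ArithmeticFunction.vonMangoldt_apply_prime Nat.prime_two]; norm_num
  have h3 : ArithmeticFunction.vonMangoldt 3 = Real.log 3 := by
    rw [ArithmeticFunction.vonMangoldt_apply_prime Nat.prime_three]; norm_num
  rw [h1, h2, h3]; push_cast; ring

/-- `Ψ(log 4) − C/4 ∈ [−4.2512, −4.2503]`. [folklore] -/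
theorem zetaScrew_log_four_sub_bounds :
    (-4.2512 : ℝ) ≤ zetaScrew (Real.log 4) - (∑' k : ℕ, 1 / ((k : ℝ) + 1 / 4) ^ 2) / 4 ∧
    zetaScrew (Real.log 4) - (∑' k : ℕ, 1 / ((k : ℝ) + 1 / 4) ^ 2) / 4 ≤ -4.2503 := by
  rw [zetaScrew_log_eq_sqrt (by norm_num : (1:ℝ) ≤ 4), zetaScrewPrimeSum_log_four]
  have hs4 : Real.sqrt 4 = 2 := by
    rw [show (4:ℝ) = 2 ^ 2 by norm_num, Real.sqrt_sq (by norm_num)]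
  have hl4 : Real.log 4 = 2 * Real.log 2 := by
    rw [show (4:ℝ) = 2 ^ 2 by norm_num, Real.log_pow]; norm_num
  rw [hs4, hl4]
  set r : ℝ := Real.sqrt 2 with hr
  have hr2 : r ^ 2 = 2 := Real.sq_sqrt (by norm_num)
  have hr0 : 0 < r := Real.sqrt_pos.mpr (by norm_num)
  have hrlo : (1.41421 : ℝ) < r := by nlinarith
  have hrhi : r < (1.41422 : ℝ) := by nlinarith
  set s : ℝ := Real.sqrt 3 with hs
  have hs2 : s ^ 2 = 3 := Real.sq_sqrt (by norm_num)
  have hs0 : 0 < s := Real.sqrt_pos.mpr (by norm_num)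
  have hslo : (1.73205 : ℝ) < s := by nlinarith
  have hshi : s < (1.73206 : ℝ) := by nlinarith
  have hA := slope_bounds₄; have hl := Real.log_two_gt_d9; have hl' := Real.log_two_lt_d9
  have hl3 := log_three_bounds₄; have hΦ := lerch_four_bounds
  set Φ := ∑' k : ℕ, (((4:ℝ) ^ 2)⁻¹) ^ k / ((k : ℝ) + 1 / 4) ^ 2 with hΦdef
  set A := Real.eulerMascheroniConstant + Real.pi / 2 + 3 * Real.log 2 + Real.log Real.pi with hAdef
  -- prime sum pieces: log 2/r = (r/2) log 2, log 3/s = (s/3) log 3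
  have hrinv : Real.log 2 / r = r / 2 * Real.log 2 := by field_simp; nlinarith
  have hsinv : Real.log 3 / s = s / 3 * Real.log 3 := by field_simp; nlinarith
  rw [hrinv, hsinv, show 2 * Real.log 2 - Real.log 2 = Real.log 2 by ring]
  have hq1 : 0.33972 ≤ r / 2 * Real.log 2 * Real.log 2 ∧
      r / 2 * Real.log 2 * Real.log 2 ≤ 0.33974 := by
    have h1 := mul_bounds₄ hrlo.le hrhi.le hl.le hl'.le (by norm_num) (by norm_num)
    have h2 := mul_bounds₄ h1.1 h1.2 hl.le hl'.le (by norm_num) (by norm_num)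
    constructor <;> linarith [h2.1, h2.2]
  have hq2 : 0.18241 ≤ s / 3 * Real.log 3 * (2 * Real.log 2 - Real.log 3) ∧
      s / 3 * Real.log 3 * (2 * Real.log 2 - Real.log 3) ≤ 0.1825 := by
    have h1 := mul_bounds₄ hslo.le hshi.le hl3.1.le hl3.2.le (by norm_num) (by norm_num)
    have hd1 : (0.2875943 : ℝ) ≤ 2 * Real.log 2 - Real.log 3 := by linarith [hl3.2]
    have hd2 : 2 * Real.log 2 - Real.log 3 ≤ 0.2876944 := by linarith [hl3.1]
    have h2 := mul_bounds₄ h1.1 h1.2 hd1 hd2 (by norm_num) (by norm_num)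
    constructor <;> linarith [h2.1, h2.2]
  have hp1 : 3.72317 ≤ 2 * Real.log 2 / 2 * A ∧ 2 * Real.log 2 / 2 * A ≤ 3.7238 := by
    have h := mul_bounds₄ hl.le hl'.le hA.1.le hA.2.le (by norm_num) (by norm_num)
    constructor <;> linarith [h.1, h.2]
  have hΦ8 : 2.0050994 ≤ (2:ℝ) / 4 * Φ / 4 ∧ (2:ℝ) / 4 * Φ / 4 ≤ 2.0050995 := by
    constructor <;> linarith [hΦ.1, hΦ.2]
  constructor <;> linarith [hq1.1, hq1.2, hq2.1, hq2.2, hp1.1, hp1.2, hΦ8.1, hΦ8.2]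

/-- `Ψ(log(4/3)) − C/4 ∈ [−4.2511, −4.2506]`. [folklore] -/
theorem zetaScrew_log_four_thirds_sub_bounds :
    (-4.2511 : ℝ) ≤ zetaScrew (Real.log (4 / 3)) - (∑' k : ℕ, 1 / ((k : ℝ) + 1 / 4) ^ 2) / 4 ∧
    zetaScrew (Real.log (4 / 3)) - (∑' k : ℕ, 1 / ((k : ℝ) + 1 / 4) ^ 2) / 4 ≤ -4.2506 := by
  have hprime : zetaScrewPrimeSum (Real.log (4 / 3)) = 0 := by
    apply zetaScrewPrimeSum_eq_zero_of_abs_lt_log_two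
    rw [abs_of_pos (Real.log_pos (by norm_num))]
    exact Real.log_lt_log (by norm_num) (by norm_num)
  rw [zetaScrew_log_eq_sqrt (by norm_num : (1:ℝ) ≤ 4 / 3), hprime,
    Real.log_div (by norm_num) (by norm_num)]
  have hl4 : Real.log 4 = 2 * Real.log 2 := by
    rw [show (4:ℝ) = 2 ^ 2 by norm_num, Real.log_pow]; norm_num
  rw [hl4]
  set s : ℝ := Real.sqrt (4 / 3) with hs
  have hs2 : s ^ 2 = 4 / 3 := Real.sq_sqrt (by norm_num)
  have hs0 : 0 < s := Real.sqrt_pos.mpr (by norm_num)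
  have hslo : (1.1547005 : ℝ) < s := by nlinarith
  have hshi : s < (1.1547006 : ℝ) := by nlinarith
  have hA := slope_bounds₄; have hl := Real.log_two_gt_d9; have hl' := Real.log_two_lt_d9
  have hl3 := log_three_bounds₄; have hΦ := lerch_four_thirds_bounds
  set Φ := ∑' k : ℕ, (((4/3:ℝ) ^ 2)⁻¹) ^ k / ((k : ℝ) + 1 / 4) ^ 2 with hΦdef
  set A := Real.eulerMascheroniConstant + Real.pi / 2 + 3 * Real.log 2 + Real.log Real.pi with hAdef
  have hp1 : 0.77239 ≤ (2 * Real.log 2 - Real.log 3) / 2 * A ∧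
      (2 * Real.log 2 - Real.log 3) / 2 * A ≤ 0.7728 := by
    have hd1 : (0.2875943 : ℝ) ≤ 2 * Real.log 2 - Real.log 3 := by linarith [hl3.2]
    have hd2 : 2 * Real.log 2 - Real.log 3 ≤ 0.2876944 := by linarith [hl3.1]
    have h := mul_bounds₄ hd1 hd2 hA.1.le hA.2.le (by norm_num) (by norm_num)
    constructor <;> linarith [h.1, h.2]
  have hp2 : 3.5611734 ≤ s / (4 / 3) * Φ / 4 ∧ s / (4 / 3) * Φ / 4 ≤ 3.5611739 := by
    have h := mul_bounds₄ hslo.le hshi.le hΦ.1 hΦ.2 (by norm_num) (by norm_num)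
    constructor <;> linarith [h.1, h.2]
  have ht1 : 0.0829035 ≤ 4 * (s + s / (4 / 3) - 2) ∧ 4 * (s + s / (4 / 3) - 2) ≤ 0.0829042 := by
    constructor <;> linarith
  constructor <;> linarith [hp1.1, hp1.2, hp2.1, hp2.2, ht1.1, ht1.2]

/-- `det S_4` in terms of the five values `Ψ(log 2), Ψ(log 3), Ψ(log 4), Ψ(log(3/2)), Ψ(log(4/3))`. [folklore] -/
theorem screwDet_three_eq :
    screwDet 3 =
      (2 * zetaScrew (Real.log 2)) * (2 * zetaScrew (Real.log 3)) * (2 * zetaScrew (Real.log 4))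
      + 2 * (zetaScrew (Real.log 2) + zetaScrew (Real.log 3) - zetaScrew (Real.log (3 / 2)))
          * zetaScrew (Real.log 4)
          * (zetaScrew (Real.log 3) + zetaScrew (Real.log 4) - zetaScrew (Real.log (4 / 3)))
      - (2 * zetaScrew (Real.log 2))
          * (zetaScrew (Real.log 3) + zetaScrew (Real.log 4) - zetaScrew (Real.log (4 / 3))) ^ 2
      - (2 * zetaScrew (Real.log 3)) * zetaScrew (Real.log 4) ^ 2
      - (2 * zetaScrew (Real.log 4))
          * (zetaScrew (Real.log 2) + zetaScrew (Real.log 3) - zetaScrew (Real.log (3 / 2))) ^ 2 := by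
  have hlog23 : Real.log 2 - Real.log 3 = -Real.log (3 / 2) := by
    rw [Real.log_div (by norm_num) (by norm_num)]; ring
  have hl4 : Real.log 4 = 2 * Real.log 2 := by
    rw [show (4:ℝ) = 2 ^ 2 by norm_num, Real.log_pow]; norm_num
  have hlog24 : Real.log 2 - Real.log 4 = -Real.log 2 := by rw [hl4]; ring
  have hlog34 : Real.log 3 - Real.log 4 = -Real.log (4 / 3) := by
    rw [Real.log_div (by norm_num) (by norm_num)]; ring
  have h12 : zetaScrewKernel (Real.log 2) (Real.log 3)
      = zetaScrew (Real.log 2) + zetaScrew (Real.log 3) - zetaScrew (Real.log (3 / 2)) := by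
    rw [zetaScrewKernel_def, hlog23, zetaScrew_neg]
  have h13 : zetaScrewKernel (Real.log 2) (Real.log 4) = zetaScrew (Real.log 4) := by
    rw [zetaScrewKernel_def, hlog24, zetaScrew_neg]; ring
  have h23 : zetaScrewKernel (Real.log 3) (Real.log 4)
      = zetaScrew (Real.log 3) + zetaScrew (Real.log 4) - zetaScrew (Real.log (4 / 3)) := by
    rw [zetaScrewKernel_def, hlog34, zetaScrew_neg]
  have h21 := (zetaScrewKernel_comm (Real.log 3) (Real.log 2)).trans h12
  have h31 := (zetaScrewKernel_comm (Real.log 4) (Real.log 2)).trans h13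
  have h32 := (zetaScrewKernel_comm (Real.log 4) (Real.log 3)).trans h23
  have c0 : (((((0 : Fin 3) : ℕ) + 2 : ℕ)) : ℝ) = 2 := by norm_num
  have c1 : (((((1 : Fin 3) : ℕ) + 2 : ℕ)) : ℝ) = 3 := by norm_num
  have c2 : (((((2 : Fin 3) : ℕ) + 2 : ℕ)) : ℝ) = 4 := by norm_num
  rw [screwDet, Matrix.det_fin_three]
  simp only [screwMatrix_apply, c0, c1, c2, zetaScrewKernel_self, h12, h13, h23, h21, h31, h32]
  ring

/-- Pure algebra behind `det S_4 > 0`: with the proxy entries in their certified boxes and `δ ≥ 0`,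
the determinant of `S₀ + δ(I + J)/4` is positive (it is a cubic in `δ` with non-negative coefficients
and constant term `det S₀ ≥ 2.7e−4`). [folklore] -/
private theorem det_three_proxy_pos {a b c d e δ : ℝ}
    (ha1 : 0.11405 ≤ a) (ha2 : a ≤ 0.11525) (hd1 : 0.12085 ≤ d) (hd2 : d ≤ 0.12305)
    (hb1 : 0.082625 ≤ b) (hb2 : b ≤ 0.085025) (hc1 : 0.041825 ≤ c) (hc2 : c ≤ 0.042725)
    (he1 : 0.059825 ≤ e) (he2 : e ≤ 0.062325) (hδ0 : 0 ≤ δ) :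
    0 < (2 * (a / 2 + δ / 4)) * (2 * (d / 2 + δ / 4)) * (2 * (c + δ / 4))
      + 2 * ((a / 2 + δ / 4) + (d / 2 + δ / 4) - (a / 2 + d / 2 - b + δ / 4)) * (c + δ / 4)
          * ((d / 2 + δ / 4) + (c + δ / 4) - (d / 2 + c - e + δ / 4))
      - (2 * (a / 2 + δ / 4)) * ((d / 2 + δ / 4) + (c + δ / 4) - (d / 2 + c - e + δ / 4)) ^ 2
      - (2 * (d / 2 + δ / 4)) * (c + δ / 4) ^ 2
      - (2 * (c + δ / 4)) * ((a / 2 + δ / 4) + (d / 2 + δ / 4) - (a / 2 + d / 2 - b + δ / 4)) ^ 2 := by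
  set f : ℝ := 2 * c with hf
  have hf1 : 0.08365 ≤ f := by rw [hf]; linarith
  have hf2 : f ≤ 0.08545 := by rw [hf]; linarith
  have key : (2 * (a / 2 + δ / 4)) * (2 * (d / 2 + δ / 4)) * (2 * (c + δ / 4))
      + 2 * ((a / 2 + δ / 4) + (d / 2 + δ / 4) - (a / 2 + d / 2 - b + δ / 4)) * (c + δ / 4)
          * ((d / 2 + δ / 4) + (c + δ / 4) - (d / 2 + c - e + δ / 4))
      - (2 * (a / 2 + δ / 4)) * ((d / 2 + δ / 4) + (c + δ / 4) - (d / 2 + c - e + δ / 4)) ^ 2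
      - (2 * (d / 2 + δ / 4)) * (c + δ / 4) ^ 2
      - (2 * (c + δ / 4)) * ((a / 2 + δ / 4) + (d / 2 + δ / 4) - (a / 2 + d / 2 - b + δ / 4)) ^ 2
      = (a * d * f + 2 * b * c * e - a * e ^ 2 - d * c ^ 2 - f * b ^ 2)
        + ((d * f - e ^ 2) + (a * f - c ^ 2) + (a * d - b ^ 2) + (c * e - b * f) + (b * e - c * d)
            + (b * c - a * e)) / 2 * δ
        + (3 * (a + d + f) - 2 * (b + c + e)) / 16 * δ ^ 2 + δ ^ 3 / 16 := by
    rw [hf]; ring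
  rw [key]
  clear_value f
  have p1 := mul_bounds₄ ha1 ha2 hd1 hd2 (by norm_num) (by norm_num)
  have p_adf := mul_bounds₄ p1.1 p1.2 hf1 hf2 (by norm_num) (by norm_num)
  have p2 := mul_bounds₄ hb1 hb2 hc1 hc2 (by norm_num) (by norm_num)
  have p_bce := mul_bounds₄ p2.1 p2.2 he1 he2 (by norm_num) (by norm_num)
  have p_ee := mul_bounds₄ he1 he2 he1 he2 (by norm_num) (by norm_num)
  have p_aee := mul_bounds₄ ha1 ha2 p_ee.1 p_ee.2 (by norm_num) (by norm_num)
  have p_cc := mul_bounds₄ hc1 hc2 hc1 hc2 (by norm_num) (by norm_num)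
  have p_dcc := mul_bounds₄ hd1 hd2 p_cc.1 p_cc.2 (by norm_num) (by norm_num)
  have p_bb := mul_bounds₄ hb1 hb2 hb1 hb2 (by norm_num) (by norm_num)
  have p_fbb := mul_bounds₄ hf1 hf2 p_bb.1 p_bb.2 (by norm_num) (by norm_num)
  have hc0pos : (0.00027 : ℝ) ≤ a * d * f + 2 * b * c * e - a * e ^ 2 - d * c ^ 2 - f * b ^ 2 := by
    have e1 : a * e ^ 2 = a * (e * e) := by ring
    have e2 : d * c ^ 2 = d * (c * c) := by ring
    have e3 : f * b ^ 2 = f * (b * b) := by ring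
    rw [e1, e2, e3]
    linarith [p_adf.1, p_bce.1, p_aee.2, p_dcc.2, p_fbb.2]
  have p_df := mul_bounds₄ hd1 hd2 hf1 hf2 (by norm_num) (by norm_num)
  have p_af := mul_bounds₄ ha1 ha2 hf1 hf2 (by norm_num) (by norm_num)
  have p_ce := mul_bounds₄ hc1 hc2 he1 he2 (by norm_num) (by norm_num)
  have p_bf := mul_bounds₄ hb1 hb2 hf1 hf2 (by norm_num) (by norm_num)
  have p_be := mul_bounds₄ hb1 hb2 he1 he2 (by norm_num) (by norm_num)
  have p_cd := mul_bounds₄ hc1 hc2 hd1 hd2 (by norm_num) (by norm_num)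
  have p_ae := mul_bounds₄ ha1 ha2 he1 he2 (by norm_num) (by norm_num)
  have hc1nn : (0 : ℝ) ≤ ((d * f - e ^ 2) + (a * f - c ^ 2) + (a * d - b ^ 2) + (c * e - b * f)
      + (b * e - c * d) + (b * c - a * e)) / 2 := by
    have e1 : e ^ 2 = e * e := by ring
    have e2 : c ^ 2 = c * c := by ring
    have e3 : b ^ 2 = b * b := by ring
    rw [e1, e2, e3]
    linarith [p_df.1, p_ee.2, p_af.1, p_cc.2, p1.1, p_bb.2, p_ce.1, p_bf.2, p_be.1, p_cd.2, p2.1,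
      p_ae.2]
  have hc2nn : (0 : ℝ) ≤ (3 * (a + d + f) - 2 * (b + c + e)) / 16 := by linarith
  have t1 := mul_nonneg hc1nn hδ0; have t2 := mul_nonneg hc2nn (pow_nonneg hδ0 2)
  linarith [t1, t2, pow_nonneg hδ0 3, hc0pos]

/-- **`det S_4 > 0`, unconditionally** (numerically `5.66e−4`; certified here `> 2e−4`). [folklore] -/
theorem screwDet_three_pos : 0 < screwDet 3 := by
  rw [screwDet_three_eq]
  set C : ℝ := ∑' k : ℕ, 1 / ((k : ℝ) + 1 / 4) ^ 2 with hC
  have hC0 := lerch_const_ge₄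
  have h2 := zetaScrew_log_two_sub_bounds; have h3 := zetaScrew_log_three_sub_bounds
  have h32 := zetaScrew_log_three_halves_sub_bounds
  have h4 := zetaScrew_log_four_sub_bounds; have h43 := zetaScrew_log_four_thirds_sub_bounds
  -- proxy entries around the partial sum `C ≥ 17.1721`; true entries = proxy + δ(I + J)/4
  obtain ⟨δ, hδ⟩ : ∃ δ : ℝ, δ = C - 17.1721 := ⟨_, rfl⟩
  obtain ⟨a, ha⟩ : ∃ a : ℝ, a = 17.1721 / 2 + 2 * (zetaScrew (Real.log 2) - C / 4) := ⟨_, rfl⟩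
  obtain ⟨d, hd⟩ : ∃ d : ℝ, d = 17.1721 / 2 + 2 * (zetaScrew (Real.log 3) - C / 4) := ⟨_, rfl⟩
  obtain ⟨b, hb⟩ : ∃ b : ℝ, b = 17.1721 / 4 + (zetaScrew (Real.log 2) - C / 4)
      + (zetaScrew (Real.log 3) - C / 4) - (zetaScrew (Real.log (3 / 2)) - C / 4) := ⟨_, rfl⟩
  obtain ⟨c, hc⟩ : ∃ c : ℝ, c = 17.1721 / 4 + (zetaScrew (Real.log 4) - C / 4) := ⟨_, rfl⟩
  obtain ⟨e, he⟩ : ∃ e : ℝ, e = 17.1721 / 4 + (zetaScrew (Real.log 3) - C / 4)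
      + (zetaScrew (Real.log 4) - C / 4) - (zetaScrew (Real.log (4 / 3)) - C / 4) := ⟨_, rfl⟩
  have e2 : zetaScrew (Real.log 2) = a / 2 + δ / 4 := by rw [ha, hδ]; ring
  have e3 : zetaScrew (Real.log 3) = d / 2 + δ / 4 := by rw [hd, hδ]; ring
  have e4 : zetaScrew (Real.log 4) = c + δ / 4 := by rw [hc, hδ]; ring
  have e32 : zetaScrew (Real.log (3 / 2)) = a / 2 + d / 2 - b + δ / 4 := by rw [ha, hd, hb, hδ]; ring
  have e43 : zetaScrew (Real.log (4 / 3)) = d / 2 + c - e + δ / 4 := by rw [hd, hc, he, hδ]; ring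
  have hδ0 : 0 ≤ δ := by rw [hδ]; linarith
  have ha1 : 0.11405 ≤ a ∧ a ≤ 0.11525 := by rw [ha]; constructor <;> linarith [h2.1, h2.2]
  have hd1 : 0.12085 ≤ d ∧ d ≤ 0.12305 := by rw [hd]; constructor <;> linarith [h3.1, h3.2]
  have hb1 : 0.082625 ≤ b ∧ b ≤ 0.085025 := by
    rw [hb]; constructor <;> linarith [h2.1, h2.2, h3.1, h3.2, h32.1, h32.2]
  have hc1 : 0.041825 ≤ c ∧ c ≤ 0.042725 := by rw [hc]; constructor <;> linarith [h4.1, h4.2]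
  have he1 : 0.059825 ≤ e ∧ e ≤ 0.062325 := by
    rw [he]; constructor <;> linarith [h3.1, h3.2, h4.1, h4.2, h43.1, h43.2]
  rw [e2, e3, e4, e32, e43]
  exact det_three_proxy_pos ha1.1 ha1.2 hd1.1 hd1.2 hb1.1 hb1.2 hc1.1 hc1.2 he1.1 he1.2 hδ0

/-- **`d_4 > 0`, unconditionally** (third rung; `d_4 = 0.06287…`). [folklore] -/
theorem screwPivot_four_pos : 0 < screwPivot 4 := by
  rw [show (4 : ℕ) = 2 + 2 from rfl, screwPivot_add_two]
  exact div_pos screwDet_three_pos screwDet_two_pos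

/-- **`S_4 ≻ 0`, unconditionally** (the `3 × 3` screw Gram matrix on `log 2, log 3, log 4`). [folklore] -/
theorem screwMatrix_three_posDef : (screwMatrix 3).PosDef := by
  refine screwMatrix_posDef_of_screwPivot_pos_le 3 (fun M h2 h3 => ?_) 3 le_rfl
  interval_cases M
  · exact screwPivot_two_pos
  · exact screwPivot_three_pos
  · exact screwPivot_four_pos

end Summit.RiemannHypothesis.RiemannHypothesis.Theorems.IntegerScrew
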